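import Summits.ABC.ABC.Theses.DefiniteXi
import Summits.ABC.ABC.Theorems.DefiniteXiSteinbergCoreSplit
import HarnessLib

/-!
# Strategist note (crux stmt-ABC-15024 `SteinbergCore`): the atom `PrimeToSixDegreeBound` is abc MODULO THE ROUTE'S OTHER BINDERS

Kernel-checked bookkeeping for the STRATEGY CENSUS (§Decomposition, "which piece remains the whole crux, and why").
With the split `SteinbergCore ⟸ XiDegreeComparison ∧ PrimeToSixDegreeBound ∧ AbcValuationProduct` (landed glue
`Summit.ABC.ABC.Theorems.steinbergCore_of_subs`, p137293) the deciding theorem `DefiniteXi.closes` becomes a theorem whose ONLY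
abc-strength binder is the atom P6 = `PrimeToSixDegreeBound`:

  `EisensteinQuarantine → XiDegreeComparison → P6 → AbcValuationProduct → DefiniteRTControlPrime → DefiniteGlue → FreyModularity →
   MinimalBoundGivesTarget → PeterssonLowerBound → DegreeBoundToABCOfPetersson → ABC`      (`abc_of_primeToSix_of_routeBinders`)

and conversely the route TARGET gives P6 outright (`primeToSix_of_freyDegreeBound`, via the landed
`primeToSixDegreeBound_of_minimalDegreeBound`).  Every binder other than P6 is abc-FREE by the route's own lights (EisensteinQuarantine: the
route's bet; XiDegreeComparison, DefiniteRTControlPrime, FreyModularity, PeterssonLowerBound: true in print; AbcValuationProduct: weak-rung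
strength, `ChildThreeOfPolyAbc.lean`; DefiniteGlue, MinimalBoundGivesTarget, DegreeBoundToABCOfPetersson: PROVED).  So RELATIVE TO THE
ROUTE'S DESIGN the atom is interchangeable with abc on Frey curves: a strategy for P6 "short of the summit" would, composed with the bets the
route already stakes, be a proof of abc — which is exactly why the census finds none and why none should be sought inside this crux.
-/

set_option linter.dupNamespace false

namespace Summit.ABC.ABC.Cruxes.SteinbergCore.Strategist

open Summit.ABC.ABC.Theses.DefiniteXi

/-- **abc from the atom and the route's other binders** (= `closes ∘ steinbergCore_of_subs`). [folklore] -/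
theorem abc_of_primeToSix_of_routeBinders
    (hEis : EisensteinQuarantine)
    (hC1 : ∀ ε : ℝ, 0 < ε → ∃ C : ℝ, ∀ a b : ℤ, IsCoprime a b → a * b * (a + b) ≠ 0 → ∀ (N : ℕ) [NeZero N], (Literature.NumberTheory.EllipticCurves.freyCurve a b).conductorNorm ℤ = N → ∀ Nm : ℕ, Odd Nm → Squarefree Nm → Odd Nm.primeFactors.card → Nm ∣ N → Literature.NumberTheory.Automorphic.brandtXi (N / Nm) Nm (fun n => (Literature.NumberTheory.EllipticCurves.freyCurve a b).LFunction n) ≠ 0 → ∃ D : Literature.NumberTheory.EllipticCurves.ModularForms.ModularParametrizationData (Literature.NumberTheory.EllipticCurves.freyCurve a b) N, (∀ D' : Literature.NumberTheory.EllipticCurves.ModularForms.ModularParametrizationData (Literature.NumberTheory.EllipticCurves.freyCurve a b) N, D.deg ≤ D'.deg) ∧ ((Literature.NumberTheory.Automorphic.brandtXi (N / Nm) Nm (fun n => (Literature.NumberTheory.EllipticCurves.freyCurve a b).LFunction n) / (ordProj[2] (Literature.NumberTheory.Automorphic.brandtXi (N / Nm) Nm (fun n => (Literature.NumberTheory.EllipticCurves.freyCurve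 a b).LFunction n)) * ordProj[3] (Literature.NumberTheory.Automorphic.brandtXi (N / Nm) Nm (fun n => (Literature.NumberTheory.EllipticCurves.freyCurve a b).LFunction n))) : ℕ) : ℝ) ≤ C * (N : ℝ) ^ ε * ((D.deg / (ordProj[2] D.deg * ordProj[3] D.deg) : ℕ) : ℝ) * ((∏ q ∈ N.primeFactors, ((Literature.NumberTheory.EllipticCurves.freyCurve a b).minimalDiscriminantNorm ℤ).factorization q : ℕ) : ℝ) ^ 3)
    (hP6 : ∀ ε : ℝ, 0 < ε → ∃ C : ℝ, ∀ a b : ℤ, IsCoprime a b → a * b * (a + b) ≠ 0 → ∀ (N : ℕ) [NeZero N], (Literature.NumberTheory.EllipticCurves.freyCurve a b).conductorNorm ℤ = N → ∀ D : Literature.NumberTheory.EllipticCurves.ModularForms.ModularParametrizationData (Literature.NumberTheory.EllipticCurves.freyCurve a b) N, (∀ D' : Literature.NumberTheory.EllipticCurves.ModularForms.ModularParametrizationData (Literature.NumberTheory.EllipticCurves.freyCurve a b) N, D.deg ≤ D'.deg) → ((D.deg / (ordProj[2] D.deg * ordProj[3] D.deg) : ℕ) : ℝ) ≤ C * (N :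 ℝ) ^ (2 + ε))
    (hAVP : ∀ ε : ℝ, 0 < ε → ∃ K : ℝ, ∀ a b c : ℕ, Literature.NumberTheory.DiophantineGeometry.IsABCTriple a b c → ((∏ p ∈ (a * b * c).primeFactors, (a * b * c).factorization p : ℕ) : ℝ) ≤ K * ((Literature.NumberTheory.DiophantineGeometry.rad a b c : ℕ) : ℝ) ^ ε)
    (hRT : DefiniteRTControlPrime) (hGlue : DefiniteGlue) (hMod : FreyModularity) (hMin : MinimalBoundGivesTarget)
    (hP : PeterssonLowerBound) (hDeg : DegreeBoundToABCOfPetersson) : _root_.ABC :=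
  closes hEis (Summit.ABC.ABC.Theorems.steinbergCore_of_subs hC1 hP6 hAVP) hRT hGlue hMod hMin hP hDeg

/-- **The route target gives the atom**: `FreyDegreeBound → P6` (a minimal datum has degree ≤ that of the datum the target
provides; then `cps n ≤ n`, the landed `primeToSixDegreeBound_of_minimalDegreeBound`). [folklore] -/
theorem primeToSix_of_freyDegreeBound (hX : FreyDegreeBound) :
    ∀ ε : ℝ, 0 < ε → ∃ C : ℝ, ∀ a b : ℤ, IsCoprime a b → a * b * (a + b) ≠ 0 → ∀ (N : ℕ) [NeZero N], (Literature.NumberTheory.EllipticCurves.freyCurve a b).conductorNorm ℤ = N → ∀ D : Literature.NumberTheory.EllipticCurves.ModularForms.ModularParametrizationData (Literature.NumberTheory.EllipticCurves.freyCurve a b) N, (∀ D' : Literature.NumberTheory.EllipticCurves.ModularForms.ModularParametrizationData (Literature.NumberTheory.EllipticCurves.freyCurve a b) N, D.deg ≤ D'.deg) → ((D.deg / (ordProj[2] D.deg * ordProj[3] D.deg) : ℕ) : ℝ) ≤ C * (N : ℝ) ^ (2 + ε) := by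
  refine Summit.ABC.ABC.Theorems.primeToSixDegreeBound_of_minimalDegreeBound ?_
  intro ε hε
  obtain ⟨C, hC⟩ := hX ε hε
  refine ⟨C, ?_⟩
  intro a b hab h0 N _ hN D hDmin
  obtain ⟨D₀, hD₀⟩ := hC a b hab h0 N hN
  have h1 : (D.deg : ℝ) ≤ (D₀.deg : ℝ) := by exact_mod_cast hDmin D₀
  exact h1.trans hD₀

end Summit.ABC.ABC.Cruxes.SteinbergCore.Strategist
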